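import Summits.ABC.ABC.Theses.DefiniteXi
import Summits.ABC.ABC.Theorems.DefiniteXiFreyModularityIsModular
import Literature.NumberTheory.EllipticCurves.X1ElevenFiveIsogeny
import Literature.NumberTheory.EllipticCurves.SzpiroLocalDataProofs
import Literature.NumberTheory.EllipticCurves.SzpiroFreyProofs
import Literature.NumberTheory.EllipticCurves.MazurTorsionGaloisStructureProofs
import Summits.ABC.ABC.Theorems.FreyDegreeBound.Negative.LevelAndConductor
import HarnessLib

/-!
# Disproof work file for crux `FreyModularity` (stmt-ABC-11340) — refuter `cdisprove`, cycle 1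

## Findings (index)

* **A. The crux** `Summit.ABC.ABC.Theses.DefiniteXi.FreyModularity` is, by the landed
  `Summit.ABC.ABC.Theorems.freyModularity_iff_forall_isModular_freyCurve` (p85939), EXACTLY
  "every Frey curve `E_(a,b)` (`a ⊥ b`, `ab(a+b) ≠ 0`) is `BCDT.IsModular`" — a theorem in print
  (Wiles 1995 / Diamond 1996 / CDT 1999 Thm 7.1.2 / BCDT 2001 Thm A).  The interfaces it is typed over
  (`ModularParametrizationData`, `IsNewformOf`, `conductorNorm`, `LFunction`) were audited honest by
  four prover passes; I re-audited the NEW interfaces of the picked line (`FramedGaloisRep`,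
  `IsTorsionGaloisRep`, `IsAbsIrreducibleOverSqrt`, `absGaloisRestrict`, `FramedRep.IsAbsolutelyIrreducible`,
  `ModPGaloisRep.IsModular`, `Isogeny`/`mazurKenku_exists_cyclic_isogeny`): all faithful (bodies, no
  placeholder `Prop` fields, junk models excluded — see B1/B2 below which EXERCISE them).  No kill of
  the crux is possible short of refuting the Modularity Theorem.
  - A1 `IsCoprime a b` is NOT load-bearing for truth: the coprime-free strengthening follows from
    Theorem A exactly as the crux does (`freyModularityWithoutCoprime_of_exists_isNewformOf`); it IS
    load-bearing for the LINE (the conductor bound `N ∣ 2⁸·rad(ab(a+b))`, hence `9 ∤ N`, `25 ∤ N`,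
    needs coprimality: `a = 3, b = 6` gives additive reduction at `3`).
  - A2 `ab(a+b) ≠ 0` IS load-bearing, for a junk reason: the singular cubic `E_(0,1)` has junk
    conductor `1` and no datum exists at level `1` (`freyModularity_false_without_nonzero`, reusing the
    sibling disprover's `FreyDegreeBound/Negative/LevelAndConductor.lean`).
  - A3 the level hypothesis `N_E = N` IS load-bearing: with `N` free the statement fails at `N = 1`
    (`S₂(Γ₀(1)) = 0`, newforms are normalised: `freyModularity_false_without_level`); with it, the
    `∀ N [NeZero N], N_E = N →` binder is cosmetic (`freyModularity_iff_forall_isModular_freyCurve`).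
    Landed as `Theorems/FreyModularity/Negative/LevelAndNonzero.lean` (p104040).
* **B. Line `Sketch`** (lead `prover-line-stmt-ABC-11340-0`, 6 stubs; joint sufficiency is PROVED
  in the skeleton, `isModular_freyCurve_of_stubs`, so `FreyModularity_of` smuggles no gap).  Every stub
  is TRUE in print; what this file adds is which hypotheses are load-bearing, with kernel-checked
  witnesses where the tree can build them:
  - B1 `stub_switch` (S3): the cyclotomic-determinant hypothesis cannot be dropped (together with
    absolute irreducibility): the TRIVIAL representation is `E[5]` of no elliptic curve
    (`not_isTorsionGaloisRep_five_one`, `switch_false_without_det`) — uses the proved Weil-pairing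
    determinant `det ρ̄_{E,5} = χ̄₅` and `χ̄₅ ≢ 1` on `Γ_ℚ`.
  - B2 `stub_absIrrSqrtFive` (S4b): the irreducibility hypothesis cannot be dropped: `11A1`
    (`25 ∤ 11 = N`, rational `5`-torsion point `(5,5)`) has every framed `ρ̄_{E,5}` reducible, hence not
    absolutely irreducible over `ℚ(√5)` (`absIrrSqrtFive_false_without_irreducible`); on the way the
    converse transport `FramedRep.IsIrreducible ρ̄ → HasIrreducibleModPGaloisRep` is proved
    (`hasIrreducibleModPGaloisRep_of_isIrreducible`).  Landed: B1 = `Negative/SwitchFalseWithoutDet.lean`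
    (p99119, ACCEPTED), B2 = `Negative/AbsIrrSqrtFiveFalseWithoutIrreducible.lean` (p100653).
  - B3 `stub_absIrrSqrtFive` (S4b): the hypothesis `¬ 25 ∣ N` IS load-bearing (not Lean-checkable here:
    needs an explicit mod-`5` image): curves whose mod-`5` image is the index-`2` subgroup
    `G = {diag(a,d) : ad ∈ (𝔽₅ˣ)²} ∪ {antidiag(a,b) : -ab ∉ (𝔽₅ˣ)²}` of `N_s(5)` (Sutherland `5Ns.2.1`;
    `|G| = 16` = CDT 1999 proof of Lemma 7.2.3, "the image of `ρ̄_{E,5}` has order 16") have `ρ̄_{E,5}`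
    irreducible and `ρ̄_{E,5}|_{ℚ(√5)}` abelian; such curves are exactly those `5`-congruent to their
    quadratic twist by `5`, and they are ADDITIVE at `5` (an inertia element of determinant `2` would
    have trace `0` in `G` but trace `3` on a Tate/ordinary curve, and supersingular tame inertia has
    order `24 ∤ 16`) — so the stub's `¬ 25 ∣ N` is exactly what excludes them.  WITNESS: `y² = x³ + 80`
    (`N = 225 = 3²·5²`, `j = 0`, CM by `ℤ[ζ₃]`; `ρ̄ = Ind_K χ̄`, `K = ℚ(√-3)`, `5` inert, and `χ̄⁴ = ε₅|_K`
    makes `ρ̄ ⊗ ε₅ ≅ ρ̄`).  Census (kit j017520, `jobs/nsplit5c.gp`): all `19 252 714` models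
    `[a₁,a₂,a₃,a₄,a₆]`, `a₁,a₃ ∈ {0,1}`, `a₂ ∈ {-1,0,1}`, `|a₄| ≤ 200`, `|a₆| ≤ 2000`: `16` models pass
    "`a_p ≡ 0 (5)` for every good `p ≡ ±2 (5)`, `p < 20000`" (all with `j = 0`, `N = 225`), and — a sanity
    check OF the stub — `0` models with `25 ∤ N` pass (j016573: same on a smaller box).  Non-CM witnesses
    exist (the genus-`0` curve `X_G` has the rational CM point above, hence `X_G ≅ ℙ¹`), outside the box.
  - B4 `stub_nineTransfer` (S6): true as stated (semistability at `ℓ = 3 ≠ 5` is read off `E[5]|_{I₃}`: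
    a `5`-group for semistable `E`, containing an element of order prime to `5` for additive `E'`,
    the wild part being equal by the tree's `wildConductorExponent_eq_of_isTorsionGaloisRep_int`); the
    analogue with `9` replaced by `3` (good reduction transfers) is FALSE (Ribet level-lowering pairs:
    `E'` multiplicative at `3` with `5 ∣ v₃(Δ')` has `E'[5]` unramified at `3`).  Not attacked further.
  - B5 `stub_switch` as stated quantifies over ALL absolutely irreducible `ρ̄` with cyclotomic
    determinant, i.e. it is Shepherd-Barron–Taylor 1997 Thm 1.2 + BCDT §2.2 (verbatim the tree fact
    `BCDT.exists_isTorsionGaloisRep_five_and_surjective_three`), whereas the line only needs it for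
    `ρ̄ = ρ̄_{E,5}` of a Frey curve, where `[E] ∈ X_E(5)(ℚ)` makes the twist `≅ ℙ¹` for free (Wiles Ch. 5
    / Hilbert irreducibility).  Information for the lead, not a defect.
  - B6 `stub_liftThree`/`stub_liftFive` conclude `IsModular W`, true for every elliptic `W/ℚ`: no
    hypothesis of S1/S2 is load-bearing for TRUTH (only for provability by 1995–96 technology).
  - B7 (proof obligation inside S4b, for the lead) the skeleton's docstring argument "an inertia element at
    `5` of determinant of order `4` … `ρ̄(σ) ∼ (χ̄₅(σ) *; 0 1)` does not square to a scalar" covers the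
    ordinary and multiplicative cases only; a Frey curve with `5 ∤ abc` may be SUPERSINGULAR at `5`
    (`a₅ = 0`), where `ρ̄|_{I₅} ≅ ψ₂ ⊕ ψ₂⁵` (Serre 1972 Prop. 12, `e = 1`): a tame generator has
    `det = ψ₂⁶` of order `4` (so lies outside `Γ_{ℚ(√5)}`) and its square has eigenvalues `ψ₂², ψ₂¹⁰`,
    not scalar since `ψ₂` has order `24` — the same conclusion, but it needs the level-`2` inertia shape
    (`ModPGaloisRep.HasLevelTwoInertiaShape`, `EllipticCurves/GoodReductionInertia`), not the Borel shape.
  - B8 (structure) case A of `isModular_freyCurve_of_stubs` (S1 applied to `E` itself when some `ρ̄₃` is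
    absolutely irreducible over `ℚ(√-3)`) is logically redundant: by S4a every Frey curve can take road B;
    S1 is still needed, for the switched curve `E'`.  Not a defect.

Everything below is `sorry`-free except the single documented near-miss `near_miss_absIrrSqrtFive_without_25`
(B3), whose witness is an explicit curve but whose mod-`5` image is not computable in the tree.
-/

set_option linter.dupNamespace false

noncomputable section

open scoped MatrixGroups

open Literature.NumberTheory.EllipticCurves
open Literature.NumberTheory.EllipticCurves.ModularForms
open Literature.NumberTheory.Automorphic
open Literature.NumberTheory.Automorphic.BCDT
open Literature.NumberTheory.GaloisRepresentations
open WeierstrassCurve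

namespace Summit.ABC.ABC.Cruxes.FreyModularity.Disproof

/-! ## A. The crux -/

/-- A0. What the crux says (landed iff, p85939): modularity (BCDT condition (2)) of every Frey curve.
[cite: BCDTJAMS2001, Introduction, condition (2)] -/
example : Summit.ABC.ABC.Theses.DefiniteXi.FreyModularity ↔
    ∀ a b : ℤ, IsCoprime a b → a * b * (a + b) ≠ 0 →
      ∀ [NeZero ((freyCurve a b).conductorNorm ℤ)], BCDT.IsModular (freyCurve a b) :=
  Summit.ABC.ABC.Theorems.freyModularity_iff_forall_isModular_freyCurve

/-- A1. The crux with the coprimality hypothesis DROPPED. [folklore] -/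
def FreyModularityWithoutCoprime : Prop :=
  ∀ a b : ℤ, a * b * (a + b) ≠ 0 → ∀ (N : ℕ) [NeZero N],
    (freyCurve a b).conductorNorm ℤ = N →
      Nonempty (ModularParametrizationData (freyCurve a b) N)

/-- A1. `IsCoprime` is not load-bearing for the truth of the crux: the coprime-free strengthening is
equally a consequence of the Modularity Theorem (`exists_isNewformOf`, BCDT Thm A) — same one-line
reduction as the provers' `freyModularity_of_exists_isNewformOf'`, which never uses coprimality.
[cite: BCDTJAMS2001, Thm. A] -/
theorem freyModularityWithoutCoprime_of_exists_isNewformOf (h : exists_isNewformOf) :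
    FreyModularityWithoutCoprime := by
  intro a b h0 N _ hN
  haveI := isElliptic_freyCurve h0
  subst hN
  haveI : NeZero ((freyCurve a b).conductorNorm ℤ) := ⟨(conductorNorm_pos_holds _).ne'⟩
  exact (Summit.ABC.ABC.Theorems.nonempty_modularParametrizationData_iff_isModularAt _ _).mpr
    (h (freyCurve a b))

/-- A1. …and it trivially implies the crux (so the two are equivalent given Theorem A; recorded for
the planner: the hypothesis exists for the LINE's conductor bound, not for the statement). [folklore] -/
theorem freyModularity_of_freyModularityWithoutCoprime (h : FreyModularityWithoutCoprime) :
    Summit.ABC.ABC.Theses.DefiniteXi.FreyModularity :=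
  fun a b _ h0 N _ hN ↦ h a b h0 N hN

/-- A2. `ab(a+b) ≠ 0` dropped: (junk-)false at `(a,b) = (0,1)` — the singular cubic has conductor `1`
(`FreyDegreeBound.Negative.conductorNorm_of_Δ_eq_zero`) and level `1` carries no datum
(`FreyDegreeBound.Negative.isEmpty_modularParametrizationData_one`). [folklore] -/
theorem freyModularity_false_without_nonzero :
    ¬ ∀ a b : ℤ, IsCoprime a b → ∀ (N : ℕ) [NeZero N],
        (freyCurve a b).conductorNorm ℤ = N →
          Nonempty (ModularParametrizationData (freyCurve a b) N) := by
  intro h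
  have hΔ : (freyCurve 0 1).Δ = 0 := by rw [freyCurve_Δ]; simp
  obtain ⟨D⟩ := h 0 1 isCoprime_one_right 1
    (Summit.ABC.ABC.Theorems.FreyDegreeBound.Negative.conductorNorm_of_Δ_eq_zero _ hΔ)
  exact (Summit.ABC.ABC.Theorems.FreyDegreeBound.Negative.isEmpty_modularParametrizationData_one
    (freyCurve 0 1)).false D

/-- A3. Level hypothesis `N_E = N` dropped: false at `a = b = 1`, `N = 1` (no datum at level `1`).
[folklore] -/
theorem freyModularity_false_without_level :
    ¬ ∀ a b : ℤ, IsCoprime a b → a * b * (a + b) ≠ 0 → ∀ (N : ℕ) [NeZero N],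
        Nonempty (ModularParametrizationData (freyCurve a b) N) := by
  intro h
  obtain ⟨D⟩ := h 1 1 isCoprime_one_left (by norm_num) 1
  exact (Summit.ABC.ABC.Theorems.FreyDegreeBound.Negative.isEmpty_modularParametrizationData_one
    (freyCurve 1 1)).false D

/-! ## B. Line `Sketch`: load-bearing hypotheses of the stubs -/

/-! ### B1. `stub_switch` without the determinant (and irreducibility) hypotheses is false -/

/-- B1. `stub_switch` (S3) with BOTH hypotheses on `ρ̄` dropped. [folklore] -/
def SwitchWithoutDet : Prop :=
  ∀ ρ : ModPGaloisRep ℚ (ZMod 5) 2,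
    ∃ (W : WeierstrassCurve ℚ) (_ : W.IsElliptic), W.IsTorsionGaloisRep 5 ρ ∧
      ∃ ρ₃ : ModPGaloisRep ℚ (ZMod 3) 2, W.IsTorsionGaloisRep 3 ρ₃ ∧ Function.Surjective ρ₃

/-- B1. **The trivial representation is not `E[5]` of any elliptic curve over `ℚ`**: by the (proved)
Weil-pairing determinant `det ρ̄_{E,5} = χ̄₅` (`det_eq_modPCyclotomicCharacter_of_isTorsionGaloisRep_holds`)
a trivial `ρ̄_{E,5}` would force `χ̄₅ ≡ 1` on `Γ_ℚ`, contradicting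
`X1Eleven.exists_modPCyclotomicCharacterZMod_five_ne_one`.  (Interface sanity: `IsTorsionGaloisRep`
is not junk-satisfiable.) [cite: SilvermanCSS1997, Ch. II §7 Proposition] -/
theorem not_isTorsionGaloisRep_five_one (W : WeierstrassCurve ℚ) [W.IsElliptic] :
    ¬ W.IsTorsionGaloisRep 5 (1 : ModPGaloisRep ℚ (ZMod 5) 2) := by
  intro h
  obtain ⟨σ, hσ⟩ := X1Eleven.exists_modPCyclotomicCharacterZMod_five_ne_one
  apply hσ
  have hdet := W.det_eq_modPCyclotomicCharacter_of_isTorsionGaloisRep_holds 5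
    (1 : ModPGaloisRep ℚ (ZMod 5) 2) h σ
  have h1 : (1 : ModPGaloisRep ℚ (ZMod 5) 2) σ = 1 := rfl
  rw [← hdet, h1, map_one]

/-- B1. Hence `stub_switch` with its hypotheses on `ρ̄` dropped is false (witness: `ρ̄ = 1`).  The
load-bearing one is the cyclotomic determinant (absolute irreducibility alone is not needed for the
existence of `E`, Shepherd-Barron–Taylor 1997 Thm 1.2, but the tree cannot yet build an absolutely
irreducible `ρ̄` with non-cyclotomic determinant to separate the two). [folklore] -/
theorem switch_false_without_det : ¬ SwitchWithoutDet := fun h ↦ by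
  obtain ⟨W, hW, h1, -⟩ := h 1
  exact not_isTorsionGaloisRep_five_one W h1

/-! ### B2. `stub_absIrrSqrtFive` without the irreducibility hypothesis is false (witness `11A1`) -/

/-- B2. Converse transport to the tree's `BCDT.isIrreducible_of_hasIrreducibleModPGaloisRep`: if some
framed model `ρ̄` of `E[p]` is irreducible (Mathlib `Representation.IsIrreducible` on `𝔽_p²`), then
`E[p]` has no `Γ`-stable subgroup other than `0` and `E[p]` — push a stable subgroup `H` through the
frame `e : E[p] ≃ 𝔽_p²`; its image is an `𝔽_p`-subspace (`AddSubgroup.toZModSubmodule`) stable under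
every `ρ̄(σ)` because `e(σ • P) = ρ̄(σ) e(P)`. [folklore] -/
theorem hasIrreducibleModPGaloisRep_of_isIrreducible {F : Type} [Field F] {W : WeierstrassCurve F}
    {p : ℕ} [Fact p.Prime] {ρ : ModPGaloisRep F (ZMod p) 2} (hρ : W.IsTorsionGaloisRep p ρ)
    (hirr : FramedRep.IsIrreducible ρ) : W.HasIrreducibleModPGaloisRep p := by
  obtain ⟨e, he⟩ := hρ
  intro H hH
  let S : AddSubgroup (Fin 2 → ZMod p) := H.map e.toAddMonoidHom
  have hSmem : ∀ v, v ∈ S ↔ ∃ Q ∈ H, e Q = v := fun v ↦ by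
    rw [AddSubgroup.mem_map]
    exact ⟨fun ⟨Q, hQ, hv⟩ ↦ ⟨Q, hQ, hv⟩, fun ⟨Q, hQ, hv⟩ ↦ ⟨Q, hQ, hv⟩⟩
  let V : Subrepresentation (FramedRep.toRepresentation ρ) :=
    { toSubmodule := AddSubgroup.toZModSubmodule p S
      apply_mem_toSubmodule := fun σ v hv ↦ by
        rw [AddSubgroup.mem_toZModSubmodule] at hv ⊢
        obtain ⟨Q, hQ, rfl⟩ := (hSmem v).mp hv
        rw [FramedRep.toRepresentation_apply_apply, ← he σ Q]
        exact (hSmem _).mpr ⟨σ • Q, hH σ Q hQ, rfl⟩ }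
  have hVmem : ∀ v, v ∈ V.toSubmodule ↔ v ∈ S := fun v ↦ AddSubgroup.mem_toZModSubmodule p
  rcases hirr.eq_bot_or_eq_top V with hV | hV
  · left
    refine (AddSubgroup.eq_bot_iff_forall _).mpr fun Q hQ ↦ ?_
    have hQS : e Q ∈ V.toSubmodule := (hVmem _).mpr ((hSmem _).mpr ⟨Q, hQ, rfl⟩)
    have hbot : V.toSubmodule = ⊥ := congrArg Subrepresentation.toSubmodule hV
    rw [hbot, Submodule.mem_bot] at hQS
    exact e.injective (hQS.trans (map_zero e).symm)
  · right
    refine (AddSubgroup.eq_top_iff' _).mpr fun Q ↦ ?_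
    have htop : V.toSubmodule = ⊤ := congrArg Subrepresentation.toSubmodule hV
    have hQS : e Q ∈ V.toSubmodule := by rw [htop]; exact Submodule.mem_top
    obtain ⟨Q', hQ', hQQ'⟩ := (hSmem _).mp ((hVmem _).mp hQS)
    exact e.injective hQQ' ▸ hQ'

/-- The integral model of Cremona's `11A1`. [cite: CremonaAlgorithms1997, Table 1, N = 11, curve A1] -/
def int11A1 : WeierstrassCurve ℤ := ⟨0, -1, 1, -10, -20⟩

/-- `11A1` over `ℚ` is the base change of its integral model. [folklore] -/
theorem int11A1_baseChange : int11A1.baseChange ℚ = X1Eleven.curve11A1 := by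
  ext <;> simp [int11A1, X1Eleven.curve11A1, WeierstrassCurve.baseChange, WeierstrassCurve.map]

/-- `Δ(11A1) = -11⁵` on the integral model. [cite: CremonaAlgorithms1997, Table 1, N = 11, curve A1] -/
theorem int11A1_Δ : int11A1.Δ = -11 ^ 5 := by
  norm_num [int11A1, WeierstrassCurve.Δ, WeierstrassCurve.b₂, WeierstrassCurve.b₄,
    WeierstrassCurve.b₆, WeierstrassCurve.b₈]

/-- B2. **`5 ∤ N(11A1)`** (indeed `N = 11`; only `5 ∤ N` is needed): the integral model has
`5 ∤ Δ = -11⁵`, so it is minimal at `5` with `f₅ = 0` (`conductorExponent_eq_zero_of_not_dvd_Δ`,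
B–G 12.5.9(a)), and `N = ∏ p^{f_p}`. [cite: BombieriGubler2006, 12.5.9(a)] -/
theorem not_five_dvd_conductorNorm_curve11A1 : ¬ 5 ∣ X1Eleven.curve11A1.conductorNorm ℤ := by
  rw [← int11A1_baseChange]
  haveI : (int11A1.baseChange ℚ).IsElliptic := by rw [int11A1_baseChange]; infer_instance
  obtain ⟨v, hv⟩ := exists_place ⟨5, Nat.prime_five⟩
  have hv' : (Rat.HeightOneSpectrum.primesEquiv (R := ℤ)).symm ⟨5, Nat.prime_five⟩ = v :=
    (Rat.HeightOneSpectrum.primesEquiv (R := ℤ)).symm_apply_eq.mpr (Subtype.ext hv.symm)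
  have h5Δ : ¬ ((Rat.HeightOneSpectrum.natGenerator v : ℕ) : ℤ) ∣ int11A1.Δ := by
    rw [hv, int11A1_Δ]; decide
  have hmin : (int11A1.baseChange ℚ).IsMinimalAt v :=
    isMinimalAt_baseChange_int_of_not_pow_dvd_Δ fun h ↦ h5Δ (dvd_trans (dvd_pow_self _ (by norm_num)) h)
  have hf : (int11A1.baseChange ℚ).conductorExponent v = 0 := conductorExponent_eq_zero_of_not_dvd_Δ hmin h5Δ
  intro h5
  have hN0 : (int11A1.baseChange ℚ).conductorNorm ℤ ≠ 0 := (conductorNorm_pos_holds _).ne'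
  have hfac := factorization_conductorNorm_primesEquiv_symm (int11A1.baseChange ℚ) ⟨5, Nat.prime_five⟩
  rw [hv', hf] at hfac
  exact absurd hfac (Nat.Prime.factorization_pos_of_dvd Nat.prime_five hN0 h5).ne'

/-- B2. `stub_absIrrSqrtFive` (S4b) with the IRREDUCIBILITY hypothesis dropped. [folklore] -/
def AbsIrrSqrtFiveWithoutIrreducible : Prop :=
  ∀ (W : WeierstrassCurve ℚ) [W.IsElliptic], ¬ 25 ∣ W.conductorNorm ℤ →
    ∀ ρ : ModPGaloisRep ℚ (ZMod 5) 2, W.IsTorsionGaloisRep 5 ρ → ρ.IsAbsIrreducibleOverSqrt 5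

/-- B2. **`stub_absIrrSqrtFive` is false without irreducibility; witness `11A1`.**  `25 ∤ N(11A1)`
(`not_five_dvd_conductorNorm_curve11A1`); the rational point `T' = (5,5)` has order `5`
(`X1Eleven.five_nsmul_T'`, `T'_ne_zero`), so `E[5] ⊋ ⟨T̄'⟩ ⊋ 0` is a `Γ_ℚ`-stable line and `E[5]` is
reducible (`not_hasIrreducibleModPGaloisRep_of_addOrderOf_eq`, Mazur's `(1 *; 0 χ)` shape); a framed
`ρ̄_{E,5}` exists (`exists_isTorsionGaloisRep`), and were it absolutely irreducible over `ℚ(√5)` it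
would be irreducible over `𝔽₅` (`IsAbsIrreducibleOverSqrt.isAbsolutelyIrreducible`,
`IsAbsolutelyIrreducible.isIrreducible`), contradicting `hasIrreducibleModPGaloisRep_of_isIrreducible`.
[cite: Mazur1977, Ch. III §5, p. 157] -/
theorem absIrrSqrtFive_false_without_irreducible : ¬ AbsIrrSqrtFiveWithoutIrreducible := by
  intro h
  haveI : NeZero ((5 : ℕ) : ℚ) := ⟨by norm_num⟩
  obtain ⟨ρ, hρ⟩ := X1Eleven.curve11A1.exists_isTorsionGaloisRep 5
  have h25 : ¬ 25 ∣ X1Eleven.curve11A1.conductorNorm ℤ :=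
    fun h25 ↦ not_five_dvd_conductorNorm_curve11A1 (dvd_trans ⟨5, rfl⟩ h25)
  have hirr : FramedRep.IsIrreducible ρ :=
    (h X1Eleven.curve11A1 h25 ρ hρ).isAbsolutelyIrreducible.isIrreducible
  have hT : addOrderOf X1Eleven.T' = 5 :=
    addOrderOf_eq_prime (X1Eleven.five_nsmul_T') X1Eleven.T'_ne_zero
  exact not_hasIrreducibleModPGaloisRep_of_addOrderOf_eq X1Eleven.curve11A1 hT
    (hasIrreducibleModPGaloisRep_of_isIrreducible hρ hirr)

/-! ### B3. `stub_absIrrSqrtFive` without `¬ 25 ∣ N`: near-miss (explicit witnesses, image not computable here) -/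

/-- B3. `stub_absIrrSqrtFive` (S4b) with the hypothesis `¬ 25 ∣ N_W` dropped. [folklore] -/
def AbsIrrSqrtFiveWithout25 : Prop :=
  ∀ (W : WeierstrassCurve ℚ) [W.IsElliptic],
    ∀ ρ : ModPGaloisRep ℚ (ZMod 5) 2, W.IsTorsionGaloisRep 5 ρ →
      FramedRep.IsIrreducible ρ → ρ.IsAbsIrreducibleOverSqrt 5

/-- B3. NEAR-MISS (the only `sorry` of this file).  `AbsIrrSqrtFiveWithout25` is false: any `E/ℚ`
whose mod-`5` image is the order-`16` group `G ⊂ N_s(5)` (Sutherland `5Ns.2.1`) — equivalently `E[5] ≅ E⁽⁵⁾[5]`,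
`E` is `5`-congruent to its twist by `5` — has `ρ̄_{E,5}` irreducible (an antidiagonal Frobenius
`p ≡ ±2 (5)` has characteristic polynomial `X² + p`, irreducible mod `5`) while `ρ̄_{E,5}(Γ_{ℚ(√5)})`
is the ABELIAN group `{diag(a,d) : ad ∈ {1,4}}`.  Such `E` are additive at `5`, which is why the stub
as filed (with `¬ 25 ∣ N`) survives.  Witness: `W = [0,0,0,0,80]`, `y² = x³ + 80`, `N = 225`, `j = 0`
(CM): by Brauer–Nesbitt + Chebotarev, `ρ̄_{W,5} ≅ ρ̄_{W,5} ⊗ ε₅` iff `a_p ≡ 0 (mod 5)` for every good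
`p ≡ ±2 (mod 5)` — verified for all `2259` good `p < 20000` (kit j017520) and explained by CM theory
(`χ̄⁴ = ε₅|_K`); irreducibility over `𝔽₅` from any such `p` (`X² + p` irreducible mod `5`); oddness then
gives absolute irreducibility, and `ρ̄ ≅ ρ̄ ⊗ ε₅` gives `dim End_{Γ_{ℚ(√5)}}(ρ̄) = 2`, i.e. NOT absolutely
irreducible on `Γ_{ℚ(√5)}`.  Obstruction to a Lean proof: the tree has no way to compute `ρ̄_{E,5}(Frob_p)` for a concrete curve
(no point counting ↔ Galois action bridge at finite level), so neither the irreducibility nor the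
abelian restriction can be certified in the kernel.  What was tried: nothing in-kernel beyond locating
the missing bridge (`WeierstrassCurve.galoisRepTorsion` has no Frobenius/`a_p` interface).
[cite: ConradDiamondTaylor1999, Lemma 7.2.3 (proof, p. 554)] -/
theorem near_miss_absIrrSqrtFive_without_25 : ¬ AbsIrrSqrtFiveWithout25 := by
  sorry

end Summit.ABC.ABC.Cruxes.FreyModularity.Disproof

end
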